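import Summits.ABC.IUTFork.Conditional.WRowUnconditionalPackages
import Summits.ABC.IUTFork.Conditional.AbcOfSGenuineKWildInhabitedRow73Packages
import HarnessLib

/-!
# R-W WINDOW-TABLE, W3 «UNIFORM LEMMA» lane, INHABITED side — bad primes and admissible index SHAPES at ANY level `l` (row «W:INHABITED-BANDS», C-R72)

PROOF-ONLY support file (D-0012; 0 definitions, 0 `Prop` facts) of the abc-iut cell — D-0079 RESCUE sub-cell R-W «WINDOW Θ-SIDE INEQUALITY», seat
abc-iut-W-num-6 (gen 3). For the genuine Θ-volume data over the known abc triple of `InhUniformBandFrey73.lean` (its consumer): which primes carry bad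
fibre points at level `l` and with which pole order of `j` (`j` is regular away from `abc`; `p ≠ 2, l` — abc-iut-C-cert-3's
`ne_two_and_ne_l_of_placeOf_mem_S_pilotDataOfK`), and the divisibility class `e(K_x/ℚ_p) ∈ E₀(p)·l·ℕ` of the ramification index at a bad `x | p`
from the tree's LOWER bounds (abc-iut-W-neg-1 `GenuineK.prime_dvd_absRamificationIdx_kOf_ratPoint` / `fifteen_mul_prime_dvd_…` (Tate root),
abc-iut-W-neg-2 `GenuineK.sub_one_dvd_absRamificationIdx_kOf` (`μ_p ⊆ F`, `p ∣ 30`) / `thirty_mul_prime_dvd_…_mul_three`, abc-iut-w4-d107's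
unconditional twist factor `GenuineK.thirty_mul_prime_dvd_absRamificationIdx_kOf_mul_of_odd_pole` at an odd pole of `λ`). Pattern of abc-iut-w4-d094's
`WRow.bad_prime_frey343` / abc-iut-W-row-1's `WRow.dvd_absRamificationIdx_frey283` with the level a variable. HONEST SCOPE: classical local/global
number theory over OUR typed datum; nothing here bears on the printed inequality of [IUTchIII] Cor. 3.12; typed ≠ proved; no abc claim.
[cite: Mochizuki2012, IUTchI Def. 3.1 (b),(c) pp. 61–62, Ex. 3.2 (iv) p. 71; IUTchIV Thm. 1.10 p. 22, Cor. 2.2 (ii) proof (P5) p. 46]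
[cite: SilvermanATAEC1994, V.5 Thm. 5.3 and Cor. 5.4] [cite: SilvermanAEC2009, Prop. III.1.7(b), Prop. VII.5.1(b)] [cite: Washington1997, Prop. 2.1]
[claim: Mochizuki2012, status: disputed] for every IUT sentence.
-/

noncomputable section

open Set Function Metric NumberField IsDedekindDomain

namespace Summit.ABC.IUTFork.Conditional

open Thm311 Thm311.Real Cor312 Cor312Vol Cor312Prov Literature.IUT.LogThetaLattice Literature.IUT.LogVolume
  Literature.IUT.HodgeTheaters Literature.IUT.LogVolume.Cor22
open Literature.NumberTheory.NumberFields Literature.NumberTheory.GaloisRepresentations.Ultrametric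
open Literature.NumberTheory.DiophantineGeometry Literature.NumberTheory.DiophantineGeometry.GenEll

/-! ## §1. The admissible index shapes at the bad fibre, any level `l` -/

/-- **Index shapes at the bad fibre of `73 + 2¹³·7⁷·941² = 3¹⁶·103³·127`, any level `l`**: `e(K_x/ℚ_p) = E₀(p)·l·m` with `m ≥ 1` — `E₀ = 30, 15, 15, 5, 15, 15` over `3, 7, 73, 103, 127, 941` (abc-iut-W-row-2's `WRow.dvd_absRamificationIdx_frey73`; over `103`, `15·l ∣ 3e` gives `5·l ∣ e`).
[cite: SilvermanATAEC1994, V.5 Thm. 5.3 and Cor. 5.4] [cite: Washington1997, Prop. 2.1] [cite: Mochizuki2012, IUTchI Ex. 3.2 (iv) p. 71; IUTchIV Thm. 1.10 p. 22]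
[claim: Mochizuki2012, status: disputed] -/
theorem InhBand.shape_frey73 {l : ℕ} (T : Cor22.ThetaVolumeDatumAt (ratPoint (((73 : ℕ) : ℚ) / (5973865915867209 : ℕ))) l) (pp : Nat.Primes) :
    letI := T.instFieldF; letI := T.instNumberFieldF; letI := T.instAlgebraF; letI := T.instFieldK
    letI := T.instNumberFieldK; letI := T.instAlgebraK; letI := T.instFieldFbar; letI := T.instAlgebraFbar
    letI := T.instAlgebraKFbar; letI := T.instIsElliptic
    haveI : Fact (pp : ℕ).Prime := ⟨pp.2⟩
    ∀ x : (thetaIndex (pilotDataOfK T.D T.K)).Fibre (.inr pp), placeOf (pilotDataOfK T.D T.K) pp.1 x ∈ (pilotDataOfK T.D T.K).S →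
      ∃ m : ℕ, 1 ≤ m ∧ absRamificationIdx (pp : ℕ) (kOf (pilotDataOfK T.D T.K) pp.1 x) =
        (if (pp : ℕ) = 3 then 30 else if (pp : ℕ) = 7 then 15 else if (pp : ℕ) = 73 then 15 else if (pp : ℕ) = 103 then 5 else if (pp : ℕ) = 127 then 15 else 15) * l * m := by
  letI := T.instFieldF; letI := T.instNumberFieldF; letI := T.instAlgebraF; letI := T.instFieldK
  letI := T.instNumberFieldK; letI := T.instAlgebraK; letI := T.instFieldFbar; letI := T.instAlgebraFbar
  letI := T.instAlgebraKFbar; letI := T.instIsElliptic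
  haveI : Fact (pp : ℕ).Prime := ⟨pp.2⟩
  intro x hx
  have hpos := absRamificationIdx_pos (pp : ℕ) (kOf (pilotDataOfK T.D T.K) pp.1 x)
  obtain ⟨hpl, hcases⟩ := WRow.bad_prime_frey73 T pp x hx
  obtain ⟨h3, h7, h73, h103, h127, h941⟩ := WRow.dvd_absRamificationIdx_frey73 T pp hpl x
  have hdvd : (if (pp : ℕ) = 3 then 30 else if (pp : ℕ) = 7 then 15 else if (pp : ℕ) = 73 then 15 else if (pp : ℕ) = 103 then 5 else if (pp : ℕ) = 127 then 15 else 15) * l ∣ absRamificationIdx (pp : ℕ) (kOf (pilotDataOfK T.D T.K) pp.1 x) := by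
    rcases hcases with ⟨hp, -⟩ | ⟨hp, -⟩ | ⟨hp, -⟩ | ⟨hp, -⟩ | ⟨hp, -⟩ | ⟨hp, -⟩
    · simp only [hp]; norm_num; exact h3 hp
    · simp only [hp]; norm_num; exact h7 hp
    · simp only [hp]; norm_num; exact h73 hp
    · simp only [hp]; norm_num
      exact Nat.dvd_of_mul_dvd_mul_right (by norm_num : 0 < 3) (by have h := h103 hp; rwa [show 5 * l * 3 = 15 * l by ring])
    · simp only [hp]; norm_num; exact h127 hp
    · simp only [hp]; norm_num; exact h941 hp
  obtain ⟨m, hm⟩ := hdvd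
  refine ⟨m, ?_, hm⟩
  rcases Nat.eq_zero_or_pos m with h0 | h0
  · rw [h0, mul_zero] at hm; omega
  · exact h0

end Summit.ABC.IUTFork.Conditional

end
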